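import Summits.QuantumFields.YangMills.Theorems.BalabanLadderNTClassicalShadowTwoValley
import HarnessLib

/-!
# Crux `NT` (stmt-QuantumFields-19353), stub `stub_refpkgT : RefPkgT`: THE CLASSICAL SHADOW, III — the two-valley test under a
# general hypercubic symmetry (any coordinate permutation fixing the box and the exterior)

Helper file (`--supports stmt-QuantumFields-19353`) of the fleet lead prover of crux `NT` (unit `ym-spine-19353-p1`, GEN 14); sequel
of `…NTClassicalShadowTwoValley` (p599572), whose geometric corollary covered a single coordinate SWAP `i ↔ j`.  The disprover's
coherent exteriors include the «self-dual» family (equal abelian flux in the `(0,1)` and `(2,3)` planes), whose mirror is the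
DOUBLE transposition `(0 2)(1 3)`; this file supplies the symmetry for every coordinate permutation `σ`:

* `dens_eq_sum_plaquetteObs` — `dens_x(U) = Σ_{i<j} Re tr r(U_{p_{ij}(x)})` (the corner density read at the site itself);
* **`dens_perm`** — `dens_{σ·x}(σ·U) = dens_x(U)` for every `σ : Equiv.Perm (Fin 4)` (`plaquetteHolonomyZd_relabel_edgePerm` + the
  PencilRigidity desk's `sum_lt_perm`: a re-ordered plane contributes `Re tr ρ(U_p⁻¹) = Re tr ρ(U_p)`);
* **`kerE_dens_perm_symm`** — if `σ` fixes the cube base (`sitePerm σ c = c`) and the exterior (`relabelConfig (edgePerm σ) η = η`) then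
  `kerE^η_β(dens_{σ·x}) = kerE^η_β(dens_x)` (`BoundaryLaw.kerE_perm`);
* **`contrast_le_of_e2osc_permValley`** / **`C₂_ge_of_permValley`** — clause 2 prices a `σ`-broken two-valley ground state with contrast `Δ`
  between `x` and `σ·x`: `Δ²/4 ≤ C₂/min(d_x,d_{σx})⁴/(1+‖σx − x‖)⁴`; `mean_deficit_le_of_e1osc_permValley` — clause 1 prices the valley mean.

HONEST FRAMING.  Consequences of the registered clauses at fixed lattice geometry as `β → ∞`; necessary conditions on instances; nothing
here asserts that a two-valley exterior exists; no floor, not AF, not NT, not the seam, not the gap; not Clay.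
-/

set_option autoImplicit false

noncomputable section

open MeasureTheory Filter Topology
open Literature.MathematicalPhysics.QuantumFieldTheory Literature.MathematicalPhysics.QuantumLattice
open Literature.Probability.LatticeModels
open Summit.QuantumFields.YangMills.Cruxes.OSLegsFromFemtoAndGap.DlrCollarTransfer
open Summit.QuantumFields.YangMills.Cruxes.UVSeamRec.BoundaryLawPenetration

namespace Summit.QuantumFields.YangMills.Cruxes.NT.ClassicalShadow

variable {G : Type} [Group G] [TopologicalSpace G] [IsTopologicalGroup G] [CompactSpace G]
  [MeasurableSpace G] [BorelSpace G] (r : LatticeRep G)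

/-! ## §1 The corner density under coordinate permutations -/

/-- `dens_x(U) = Σ_{i<j} Re tr r(U_{p_{ij}(x)})`. [folklore] -/
theorem dens_eq_sum_plaquetteObs (x : Fin 4 → ℤ) (U : LGConfig 4 G) :
    dens G r x U = ∑ i : Fin 4, ∑ j : Fin 4, if i < j then plaquetteObs r.ρ x i j U else 0 := by
  show actionDensity r.ρ (configShift (-x) U) = _
  unfold actionDensity
  refine Finset.sum_congr rfl fun i _ => Finset.sum_congr rfl fun j _ => ?_
  split_ifs
  · exact (Summit.QuantumFields.YangMills.Cruxes.NT.BoundaryLaw.plane_eq_plaquetteObs G r (i, j) x U)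
  · rfl

/-- **The corner density is hypercubic-covariant**: `dens_{σ·x}(σ·U) = dens_x(U)` for every coordinate permutation `σ`. [folklore] -/
theorem dens_perm (σ : Equiv.Perm (Fin 4)) (x : Fin 4 → ℤ) (U : LGConfig 4 G) :
    dens G r (sitePerm σ x) (relabelConfig (edgePerm σ) U) = dens G r x U := by
  rw [dens_eq_sum_plaquetteObs, dens_eq_sum_plaquetteObs]
  have hP : ∀ k l : Fin 4, plaquetteObs r.ρ (sitePerm σ x) k l (relabelConfig (edgePerm σ) U) =
      plaquetteObs r.ρ x (σ.symm k) (σ.symm l) U := by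
    intro k l
    unfold plaquetteObs
    rw [← plaquetteHolonomyZd_relabel_edgePerm σ U x (σ.symm k) (σ.symm l), Equiv.apply_symm_apply, Equiv.apply_symm_apply]
  simp only [hP]
  exact Summit.QuantumFields.YangMills.Theorems.CurvatureKernel.sum_lt_perm (fun k l => plaquetteObs r.ρ x k l U)
    (fun k l => Summit.QuantumFields.YangMills.Theorems.CurvatureKernel.plaquetteObs_symm r.ρ r.mem_unitary x k l U) σ.symm

/-- **`σ`-symmetric exteriors have `σ`-symmetric kernels**: if the coordinate permutation `σ` fixes the cube base and the exterior,
then `kerE^η_β(dens_{σ·x}) = kerE^η_β(dens_x)`. [folklore] -/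
theorem kerE_dens_perm_symm (σ : Equiv.Perm (Fin 4)) (β : ℝ) {c : Fin 4 → ℤ} (hc : sitePerm σ c = c) (b : ℕ)
    {η : LGConfig 4 G} (hη : relabelConfig (edgePerm σ) η = η) (x : Fin 4 → ℤ) :
    kerE G r β c b η (dens G r (sitePerm σ x)) = kerE G r β c b η (dens G r x) := by
  have h := Summit.QuantumFields.YangMills.Cruxes.NT.BoundaryLaw.kerE_perm G r σ β c b η (dens G r (sitePerm σ x))
  rw [hc, hη] at h
  rw [h]
  congr 1
  funext U
  exact dens_perm r σ x U

/-! ## §2 The prices for a `σ`-broken two-valley ground state -/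

section Price

variable (a : ℝ → ℝ)

/-- **Clause 2 against a `σ`-broken two-valley ground state**: `Δ²/4 ≤ C₂ / min(d_x, d_{σx})⁴ / (1 + ‖σx − x‖)⁴`. [folklore] -/
theorem contrast_le_of_e2osc_permValley (ha0 : Tendsto a atTop (𝓝 0)) {C₂ ℓ : ℝ} (hℓ : 0 < ℓ)
    (hE2 : ∃ β₂ : ℝ, ∀ β : ℝ, β₂ ≤ β → ∀ (c : Fin 4 → ℤ) (b : ℕ), (b : ℝ) * a β ≤ ℓ →
      ∀ (η η' : LGConfig 4 G) (x y : Fin 4 → ℤ), 1 ≤ depth c b x → 1 ≤ depth c b y →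
        |kerCov G r β c b η (dens G r x) (dens G r y) - kerCov G r β c b η' (dens G r x) (dens G r y)| ≤
          C₂ / ((min (depth c b x) (depth c b y) : ℕ) : ℝ) ^ 4 / (1 + ‖siteToE (y - x)‖) ^ 4)
    (σ : Equiv.Perm (Fin 4)) {c : Fin 4 → ℤ} (hc : sitePerm σ c = c) (b : ℕ) {η : LGConfig 4 G}
    (hη : relabelConfig (edgePerm σ) η = η) {x : Fin 4 → ℤ} (hx : 2 ≤ depth c b x) (hy : 2 ≤ depth c b (sitePerm σ x))
    {s Δ2 : ℝ}
    (hsum : ∀ ζ ∈ cubeMinimisers G r c b η,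
      dens G r x (glueWith (cubeEdges c b) ζ η) + dens G r (sitePerm σ x) (glueWith (cubeEdges c b) ζ η) = s)
    (hdiff : ∀ ζ ∈ cubeMinimisers G r c b η,
      (dens G r x (glueWith (cubeEdges c b) ζ η) - dens G r (sitePerm σ x) (glueWith (cubeEdges c b) ζ η)) ^ 2 = Δ2) :
    Δ2 / 4 ≤ C₂ / ((min (depth c b x) (depth c b (sitePerm σ x)) : ℕ) : ℝ) ^ 4 / (1 + ‖siteToE (sitePerm σ x - x)‖) ^ 4 :=
  contrast_le_of_e2osc_twoValley r a ha0 hℓ hE2 c b hx hy η hsum hdiff fun β => (kerE_dens_perm_symm r σ β hc b hη x).symm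

/-- **`C₂ ≥ Δ² · min(d_x, d_{σx})⁴ · (1 + ‖σx − x‖)⁴ / 4`** for a `σ`-broken two-valley ground state. [folklore] -/
theorem C₂_ge_of_permValley (ha0 : Tendsto a atTop (𝓝 0)) {C₂ ℓ : ℝ} (hℓ : 0 < ℓ)
    (hE2 : ∃ β₂ : ℝ, ∀ β : ℝ, β₂ ≤ β → ∀ (c : Fin 4 → ℤ) (b : ℕ), (b : ℝ) * a β ≤ ℓ →
      ∀ (η η' : LGConfig 4 G) (x y : Fin 4 → ℤ), 1 ≤ depth c b x → 1 ≤ depth c b y →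
        |kerCov G r β c b η (dens G r x) (dens G r y) - kerCov G r β c b η' (dens G r x) (dens G r y)| ≤
          C₂ / ((min (depth c b x) (depth c b y) : ℕ) : ℝ) ^ 4 / (1 + ‖siteToE (y - x)‖) ^ 4)
    (σ : Equiv.Perm (Fin 4)) {c : Fin 4 → ℤ} (hc : sitePerm σ c = c) (b : ℕ) {η : LGConfig 4 G}
    (hη : relabelConfig (edgePerm σ) η = η) {x : Fin 4 → ℤ} (hx : 2 ≤ depth c b x) (hy : 2 ≤ depth c b (sitePerm σ x))
    {s Δ2 : ℝ}
    (hsum : ∀ ζ ∈ cubeMinimisers G r c b η,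
      dens G r x (glueWith (cubeEdges c b) ζ η) + dens G r (sitePerm σ x) (glueWith (cubeEdges c b) ζ η) = s)
    (hdiff : ∀ ζ ∈ cubeMinimisers G r c b η,
      (dens G r x (glueWith (cubeEdges c b) ζ η) - dens G r (sitePerm σ x) (glueWith (cubeEdges c b) ζ η)) ^ 2 = Δ2) :
    Δ2 * ((min (depth c b x) (depth c b (sitePerm σ x)) : ℕ) : ℝ) ^ 4 * (1 + ‖siteToE (sitePerm σ x - x)‖) ^ 4 / 4 ≤ C₂ :=
  C₂_ge_of_twoValley r a ha0 hℓ hE2 c b hx hy η hsum hdiff fun β => (kerE_dens_perm_symm r σ β hc b hη x).symm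

/-- **Clause 1 prices the valley mean of a `σ`-broken two-valley ground state**: `6N − C₁/d_x⁴ ≤ s/2`. [folklore] -/
theorem mean_deficit_le_of_e1osc_permValley (ha0 : Tendsto a atTop (𝓝 0)) {C₁ ℓ : ℝ} (hℓ : 0 < ℓ)
    (hE1 : ∃ β₁ : ℝ, ∀ β : ℝ, β₁ ≤ β → ∀ (c : Fin 4 → ℤ) (b : ℕ), (b : ℝ) * a β ≤ ℓ →
      ∀ (η η' : LGConfig 4 G) (x : Fin 4 → ℤ), 1 ≤ depth c b x →
        |kerE G r β c b η (dens G r x) - kerE G r β c b η' (dens G r x)| ≤ C₁ / (depth c b x : ℝ) ^ 4)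
    (σ : Equiv.Perm (Fin 4)) {c : Fin 4 → ℤ} (hc : sitePerm σ c = c) (b : ℕ) {η : LGConfig 4 G}
    (hη : relabelConfig (edgePerm σ) η = η) {x : Fin 4 → ℤ} (hx : 2 ≤ depth c b x) {s : ℝ}
    (hsum : ∀ ζ ∈ cubeMinimisers G r c b η,
      dens G r x (glueWith (cubeEdges c b) ζ η) + dens G r (sitePerm σ x) (glueWith (cubeEdges c b) ζ η) = s) :
    6 * (r.N : ℝ) - C₁ / (depth c b x : ℝ) ^ 4 ≤ s / 2 :=
  mean_deficit_le_of_e1osc_twoValley r a ha0 hℓ hE1 c b hx η hsum fun β => (kerE_dens_perm_symm r σ β hc b hη x).symm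

end Price

end Summit.QuantumFields.YangMills.Cruxes.NT.ClassicalShadow

end
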